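import Literature.Probability.Percolation.HutchcroftVolumeTail
import Literature.Probability.Percolation.HalfSpace
import Literature.Probability.Percolation.SlabUniqueness
import HarnessLib

/-!
# Crux `PercLowPointHalfSpace.QuantitativeBGN` (stmt-CriticalPhenomena-0913), line
# `kl-surface-susceptibility-transfer` — stub `stub_klSurfaceTail`

Helper file for the crux skeleton
`Cruxes/QuantitativeBGN/Lines/kl-surface-susceptibility-transfer.lean` (lead
prover-line-stmt-CriticalPhenomena-0913-0). Proves exactly the registered stub signature
`stub_klSurfaceTail`; lands with `--supports stmt-CriticalPhenomena-0913`.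

## Statement (`KLSurfaceTail`, the lever of the line)

Let `H = halfSpaceGraph 3 = (zdGraph 3).induce {x | 0 ≤ x 0}` be the induced half-space graph of
`ℤ³`, rooted at `o = halfSpaceOrigin 3`, and `χ_H(p) = E_p|C_H(o)| = expClusterSize H o p ∈ [0, ∞]`
its surface susceptibility. For `p, q ∈ (0,1)`, every real `M ≥ 0` with `χ_H(p) ≤ M` and every
`n ≥ 1`,

  `P^H_q(|C_H(o)| ≥ n) ≤ M · (2/n + 48 · kl(p ‖ q))`,

where `kl = binaryKL` is the binary relative entropy (`BinaryRelativeEntropy.lean`).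

## The argument (Hutchcroft 2022, arXiv:2106.06400, Thm. 1.3 + Markov)

* `H` has maximal degree `Δ = 6`: degrees do not increase under `SimpleGraph.induce`
  (`klSurfaceTail_degree_induce_le`) and `deg ≤ 2d` on `ℤ^d` (`degree_zdGraph_le`).
* The tree theorem `ClusterExploration.real_clusterSizeGe_le_of_kl` (Hutchcroft 2022, Thm. 1.3
  on any graph of maximal degree `Δ`, locally finite by `instLocallyFiniteInduce`) gives
  `P_q(|C| ≥ n) ≤ 2 P_p(|C| ≥ n) + 8 · 6 · kl(p‖q) · S_n`, `S_n = Σ_{j=1}^n P_p(|C| ≥ j)`.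
* `S_n ≤ M`: `ENNReal.ofReal S_n ≤ χ_H(p) ≤ ENNReal.ofReal M` (`ofReal_sum_real_clusterSizeGe_le`).
* Markov in the form `n · P_p(|C| ≥ n) ≤ S_n` (each of the `n` terms dominates the last one,
  `clusterSizeGe_antitone`), so `2 P_p(|C| ≥ n) ≤ 2M/n`; and `kl ≥ 0` (`binaryKL_nonneg`) gives
  `48 kl S_n ≤ 48 kl M`. Summing: `P_q ≤ M (2/n + 48 kl)`.

No new definitions. Helpers carry the crux-specific prefix `klSurfaceTail_` (shared `…Theorems`
namespace).
-/

noncomputable section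

namespace Summit.CriticalPhenomena.PercolationContinuityZ3.Theorems

open MeasureTheory Literature.Probability.Percolation Literature.Probability.LatticeModels
  Literature.Probability.Entropy
open scoped ENNReal

/-- Degrees do not increase under `SimpleGraph.induce`: the neighbours of `x` in `G.induce s`
inject (by `Subtype.val`) into the neighbours of `x.1` in `G` (for the induced `LocallyFinite`
instance `instLocallyFiniteInduce` of `SlabUniqueness.lean`). [folklore] -/
theorem klSurfaceTail_degree_induce_le {V : Type*} (G : SimpleGraph V) [G.LocallyFinite]
    (s : Set V) (x : s) : (G.induce s).degree x ≤ G.degree x.1 := by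
  classical
  rw [← SimpleGraph.card_neighborFinset_eq_degree, ← SimpleGraph.card_neighborFinset_eq_degree]
  refine Finset.card_le_card_of_injOn Subtype.val (fun y hy => ?_) Subtype.val_injective.injOn
  rw [Finset.mem_coe, SimpleGraph.mem_neighborFinset] at hy ⊢
  exact hy

/-- `Δ = 6` on the half-space graph of `ℤ³`: every vertex of `halfSpaceGraph 3` has degree at most
`6 = 2 · 3` (the constant `48 = 8 · Δ` of the stub). [folklore] -/
theorem klSurfaceTail_degree_halfSpaceGraph_le (v : halfSpace 3) :
    (halfSpaceGraph 3).degree v ≤ 6 :=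
  (klSurfaceTail_degree_induce_le (zdGraph 3) (halfSpace 3) v).trans (degree_zdGraph_le v.1)

/-- **Markov for the truncated mean**: `n · P_p(|C(x)| ≥ n) ≤ Σ_{j=1}^{n} P_p(|C(x)| ≥ j)` (each of
the `n` events `{|C(x)| ≥ j}`, `j ≤ n`, contains `{|C(x)| ≥ n}`). [folklore] -/
theorem klSurfaceTail_mul_real_clusterSizeGe_le_sum {V : Type*} (G : SimpleGraph V) (x : V)
    (p : unitInterval) (n : ℕ) :
    (n : ℝ) * (bondPercolation G p).real (clusterSizeGe x n) ≤
      ∑ j ∈ Finset.Icc 1 n, (bondPercolation G p).real (clusterSizeGe x j) := by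
  calc (n : ℝ) * (bondPercolation G p).real (clusterSizeGe x n)
      = ∑ _j ∈ Finset.Icc 1 n, (bondPercolation G p).real (clusterSizeGe x n) := by
        rw [Finset.sum_const, Nat.card_Icc, nsmul_eq_mul, Nat.add_sub_cancel]
    _ ≤ ∑ j ∈ Finset.Icc 1 n, (bondPercolation G p).real (clusterSizeGe x j) :=
        Finset.sum_le_sum fun j hj =>
          measureReal_mono (clusterSizeGe_antitone x (Finset.mem_Icc.1 hj).2)

/-- **STUB `stub_klSurfaceTail`** (`KLSurfaceTail`, line `kl-surface-susceptibility-transfer` of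
crux `PercLowPointHalfSpace.QuantitativeBGN`): Hutchcroft's Thm. 1.3 on the induced half-space graph
`H = halfSpaceGraph 3` (`Δ = 6`) followed by Markov, with the KL price paid in the surface
susceptibility. For `p, q ∈ (0,1)`, any real `M ≥ 0` with
`χ_H(p) = expClusterSize (halfSpaceGraph 3) (halfSpaceOrigin 3) p ≤ M`, and `n ≥ 1`,
`P^H_q(|C_H(o)| ≥ n) ≤ M · (2/n + 48 · kl(p‖q))`. [cite: Hutchcroft2022Triangle, Thm. 1.3] -/
theorem stub_klSurfaceTail :
    ∀ (p q : unitInterval), 0 < (p : ℝ) → (p : ℝ) < 1 → 0 < (q : ℝ) → (q : ℝ) < 1 →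
      ∀ M : ℝ, 0 ≤ M → expClusterSize (halfSpaceGraph 3) (halfSpaceOrigin 3) p ≤ ENNReal.ofReal M →
        ∀ n : ℕ, 1 ≤ n →
          (bondPercolation (halfSpaceGraph 3) q).real (clusterSizeGe (halfSpaceOrigin 3) n) ≤
            M * (2 / (n : ℝ) + 48 * binaryKL (p : ℝ) (q : ℝ)) := by
  intro p q hp0 hp1 hq0 hq1 M hM hχ n hn
  -- Hutchcroft's Thm. 1.3 on `H` with `Δ = 6`
  have h := ClusterExploration.real_clusterSizeGe_le_of_kl (G := halfSpaceGraph 3) (n := n)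
    klSurfaceTail_degree_halfSpaceGraph_le (halfSpaceOrigin 3) p q hp0 hp1 hq0 hq1
  -- the truncated mean `S_n ≤ M`
  set S : ℝ := ∑ j ∈ Finset.Icc 1 n,
    (bondPercolation (halfSpaceGraph 3) p).real (clusterSizeGe (halfSpaceOrigin 3) j) with hS
  have hSM : S ≤ M :=
    (ENNReal.ofReal_le_ofReal_iff hM).1
      ((ofReal_sum_real_clusterSizeGe_le (halfSpaceGraph 3) (halfSpaceOrigin 3) p n).trans hχ)
  -- Markov: `n · P_p(|C| ≥ n) ≤ S_n ≤ M`
  have hn0 : (0 : ℝ) < n := by exact_mod_cast hn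
  have ha : (bondPercolation (halfSpaceGraph 3) p).real (clusterSizeGe (halfSpaceOrigin 3) n) ≤
      M / n := by
    rw [le_div_iff₀ hn0, mul_comm]
    exact (klSurfaceTail_mul_real_clusterSizeGe_le_sum (halfSpaceGraph 3) (halfSpaceOrigin 3)
      p n).trans hSM
  -- `kl ≥ 0`
  have hkl : 0 ≤ binaryKL (p : ℝ) (q : ℝ) := binaryKL_nonneg hp0.le hp1.le hq0 hq1
  calc (bondPercolation (halfSpaceGraph 3) q).real (clusterSizeGe (halfSpaceOrigin 3) n)
      ≤ 2 * (bondPercolation (halfSpaceGraph 3) p).real (clusterSizeGe (halfSpaceOrigin 3) n) +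
          8 * ((6 : ℕ) : ℝ) * binaryKL (p : ℝ) (q : ℝ) * S := h
    _ ≤ 2 * (M / n) + 8 * ((6 : ℕ) : ℝ) * binaryKL (p : ℝ) (q : ℝ) * M :=
        add_le_add (mul_le_mul_of_nonneg_left ha (by norm_num))
          (mul_le_mul_of_nonneg_left hSM (by positivity))
    _ = M * (2 / (n : ℝ) + 48 * binaryKL (p : ℝ) (q : ℝ)) := by
        push_cast
        ring

end Summit.CriticalPhenomena.PercolationContinuityZ3.Theorems

end
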